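import Literature.CategoryTheory.Preadditive.BichainCondition
import Mathlib.CategoryTheory.Abelian.Basic
import Mathlib.CategoryTheory.Subobject.ArtinianObject
import Mathlib.CategoryTheory.Subobject.NoetherianObject
import Mathlib.CategoryTheory.Noetherian
import Mathlib.CategoryTheory.Subobject.Limits
import HarnessLib

/-!
# Objects of finite length satisfy the bi-chain condition (Krause 2015, Lemma 5.1; Atiyah 1956, §3)

Topic `Literature/CategoryTheory/Abelian` (new sub-folder for the abelian-category half of the Krull–Schmidt story), namespace
`Literature.CategoryTheory.KrullSchmidt`.  Second file of the CHAIN-CONDITIONS story (g41-#1 `Preadditive/BichainCondition`): the two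
chains of subobjects a bi-chain produces in `X ≅ X₀` — the images `Im(β₀ ⋯ βₙ₋₁)` (descending) and the kernels `Ker(αₙ₋₁ ⋯ α₀)`
(ascending) — and Krause's Lemma 5.1 ∕ Atiyah's remark: ARTINIAN objects make the `βₙ` eventually invertible (any category), NOETHERIAN
objects of an ABELIAN category make the `αₙ` eventually invertible, so artinian-and-noetherian (= finite length) objects satisfy the bi-chain
condition.  Everything proved; two auxiliary definitions with bodies (`Bichain.imageSubobjectSeq`, `Bichain.kernelSubobjectSeq`), no named
fact, no instance, no notation.  «Artinian ∕ noetherian object» are Mathlib's `IsArtinianObject X` ∕ `IsNoetherianObject X`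
(well-foundedness of `<` ∕ `>` on `Subobject X`).

## The sources, verbatim

Krause [Krause2015KS, §5]: «An object `X` of an abelian category has *finite length* if there exists a finite chain of subobjects
`0 = X₀ ⊆ X₁ ⊆ … ⊆ Xₙ₋₁ ⊆ Xₙ = X` such that each quotient `Xᵢ/Xᵢ₋₁` is a simple object. Note that `X` has finite length if and only if `X`
is both artinian (i.e. it satisfies the descending chain condition on subobjects) and noetherian (i.e. it satisfies the ascending chain
condition on subobjects).  **Lemma 5.1.** An object of finite length satisfies the bi-chain condition.  *Proof.* Let `X` be an object of
finite length and `Xₙ —αₙ→ Xₙ₊₁ —βₙ→ Xₙ` (`n ≥ 0`) a bi-chain with `X = X₀`. Then the subobjects `Ker(αₙ … α₁ α₀) ⊆ X` yield an ascending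
chain and the subobjects `Im(β₀ β₁ … βₙ) ⊆ X` yield a descending chain. If these chains terminate, then `αₙ` and `βₙ` are invertible for
large enough `n`.»
Atiyah [Atiyah1956, §3]: «We note that the bi-chain condition is self-dual. Moreover, if `{Aₙ, iₙ, pₙ}` is a bi-chain of `𝔄`, `Im(iₙ)` is a
descending chain and `Ker(pₙ)` is an ascending chain. Hence the bi-chain condition holds in `𝔄` if the ascending and descending chain
conditions both hold.»

## What is formalised

* §1 (any category; `e : X ≅ B.obj 0`) `Bichain.imageSubobjectSeq B e n = [δₙ ≫ e⁻¹] : Subobject X` for the composite monomorphisms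
  `δₙ = β₀ ⋯ βₙ₋₁ : Xₙ ↣ X₀` (g41-#1 `bwdComp`); it is antitone; **`Im δₙ₊₁ = Im δₙ ⟹ βₙ` is an isomorphism**
  (`isIso_bwd_of_imageSubobjectSeq_eq`: the comparison isomorphism of equal subobjects is `βₙ` after cancelling `δₙ`); hence **for an
  ARTINIAN object the `βₙ` of every bi-chain are eventually invertible** (`eventually_isIso_bwd_of_isArtinianObject`).
* §2 (zero morphisms and kernels) `Bichain.kernelSubobjectSeq B e n = kernelSubobject (e ≫ γₙ)` for the composite epimorphisms
  `γₙ = αₙ₋₁ ⋯ α₀ : X₀ ↠ Xₙ` (`fwdComp`); it is monotone (`kernelSubobject_comp_le`).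
* §3 (abelian) the step using abelianness, isolated: **`mono_of_epi_of_kernelSubobject_comp_le`** — if `g` is an epimorphism and
  `Ker(g ≫ f) ⊆ Ker g` then `f` is a monomorphism (pull the kernel of `f` back along `g`; pullbacks of epimorphisms are epimorphisms);
  so `Ker γₙ₊₁ ⊆ Ker γₙ ⟹ αₙ` is mono and epi, hence invertible (`isIso_fwd_of_kernelSubobjectSeq_le`, abelian categories are balanced), and
  **for a NOETHERIAN object the `αₙ` are eventually invertible** (`eventually_isIso_fwd_of_isNoetherianObject`).
* **Lemma 5.1** `bichainCondition_of_isArtinianObject_of_isNoetherianObject`: an artinian and noetherian object of an abelian category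
  satisfies the bi-chain condition; `bichainCondition_of_artinian_of_noetherian` for Mathlib's category-wide classes `Artinian C`,
  `Noetherian C` (Atiyah's formulation «the bi-chain condition holds in `𝔄` if the ascending and descending chain conditions both hold»).

NOT here: a `FiniteLength` predicate for objects (Mathlib has none for categories; finite length = artinian ∧ noetherian is taken as the
hypothesis, exactly Krause's «Note that …»), and the duality `IsNoetherianObject X ↔ IsArtinianObject (op X)` for abelian `C` (listed as
future work in Mathlib's `Subobject/ArtinianObject.lean`; the kernel chain is handled directly instead).

## Mathlib ∕ Literature search

Mathlib: `IsArtinianObject`, `antitone_chain_condition_of_isArtinianObject`, `IsNoetherianObject`, `monotone_chain_condition_of_isNoetherianObject`,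
`Artinian C`, `Noetherian C` (`CategoryTheory/Noetherian`), `Subobject.mk_le_mk_of_comm`, `Subobject.isoOfMkEqMk`, `Subobject.ofMkLEMk_comp`,
`kernelSubobject`, `kernelSubobject_comp_le`, `le_kernelSubobject`, `kernelSubobject_factors_iff`, `Subobject.factors_of_le`,
`Abelian.epi_pullback_of_epi_f`, `Abelian.mono_of_kernel_ι_eq_zero`, `isIso_of_mono_of_epi`; no bi-chains in Mathlib (see g41-#1).
Literature: g41-#1 `BichainCondition` (REUSED: `Bichain`, `fwdComp`, `bwdComp`, `BichainCondition`); nothing else on chain conditions in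
categories (`rg -l "IsArtinianObject|IsNoetherianObject" lean/Literature` → nothing before this file).

## References

* H. Krause, *Krull–Schmidt categories and projective covers*, Expo. Math. 33 (2015) 535–549, arXiv:1410.2822: §5, Lemma 5.1. [Krause2015KS]
* M. Atiyah, *On the Krull-Schmidt theorem with application to sheaves*, Bull. Soc. Math. France 84 (1956) 307–317: §3 (remark after the
  Definitions). [Atiyah1956]

## Provenance

Lane `lit-hodgefound` (summit `HodgeConjecture`, Track 2 foundations library), seat `lit-hodgefound-p36` (literature-prover, generation 41,
row g41-#2); Krause materialised as `paper-arxiv-1410.2822` (p0010), Atiyah as `galaxy-pdf-4113901900` (scan p. 4 = p. 310).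
-/

open CategoryTheory CategoryTheory.Limits

namespace Literature.CategoryTheory.KrullSchmidt

universe v u

variable {C : Type u} [Category.{v} C]

namespace Bichain

variable (B : Bichain C) {X : C} (e : X ≅ B.obj 0)

/-! ## §1 The descending chain `Im(β₀ β₁ ⋯ βₙ₋₁) ⊆ X` — artinian objects -/

/-- The subobjects `Im δₙ = Im(β₀ β₁ ⋯ βₙ₋₁)` of `X ≅ X₀` cut out by the composite monomorphisms of a bi-chain (Krause: «the subobjects
`Im(β₀ β₁ … βₙ) ⊆ X` yield a descending chain»; Atiyah: «`Im(iₙ)` is a descending chain»). [cite: Krause2015KS, §5 Lemma 5.1 (proof)]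
[cite: Atiyah1956, §3 (remark after the Definitions)] -/
noncomputable def imageSubobjectSeq (n : ℕ) : Subobject X :=
  haveI := B.mono_bwdComp n
  Subobject.mk (B.bwdComp n ≫ e.inv)

/-- Unfolding `imageSubobjectSeq`. [cite: Krause2015KS, §5 Lemma 5.1 (proof)] -/
theorem imageSubobjectSeq_def (n : ℕ) :
    B.imageSubobjectSeq e n = @Subobject.mk _ _ _ _ (B.bwdComp n ≫ e.inv) (by haveI := B.mono_bwdComp n; exact mono_comp _ _) :=
  rfl

/-- The chain `Im δₙ` is descending. [cite: Krause2015KS, §5 Lemma 5.1 (proof)] -/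
theorem imageSubobjectSeq_succ_le (n : ℕ) : B.imageSubobjectSeq e (n + 1) ≤ B.imageSubobjectSeq e n := by
  haveI := B.mono_bwdComp n
  haveI := B.mono_bwdComp (n + 1)
  haveI : Mono (B.bwdComp n ≫ e.inv) := mono_comp _ _
  haveI : Mono (B.bwdComp (n + 1) ≫ e.inv) := mono_comp _ _
  exact Subobject.mk_le_mk_of_comm (B.bwd n) (by simp [Category.assoc])

/-- The chain `Im δₙ` is antitone. [cite: Krause2015KS, §5 Lemma 5.1 (proof)] -/
theorem antitone_imageSubobjectSeq : Antitone (B.imageSubobjectSeq e) :=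
  antitone_nat_of_succ_le fun n => B.imageSubobjectSeq_succ_le e n

/-- If `Im δₙ₊₁ = Im δₙ` then `βₙ` is invertible (the comparison isomorphism of the two equal subobjects IS `βₙ`, by cancelling the
monomorphism `δₙ`). [cite: Krause2015KS, §5 Lemma 5.1 (proof)] -/
theorem isIso_bwd_of_imageSubobjectSeq_eq (n : ℕ) (h : B.imageSubobjectSeq e (n + 1) = B.imageSubobjectSeq e n) :
    IsIso (B.bwd n) := by
  haveI := B.mono_bwdComp n
  haveI := B.mono_bwdComp (n + 1)
  haveI : Mono (B.bwdComp n ≫ e.inv) := mono_comp _ _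
  haveI : Mono (B.bwdComp (n + 1) ≫ e.inv) := mono_comp _ _
  let i : B.obj (n + 1) ≅ B.obj n := Subobject.isoOfMkEqMk (B.bwdComp (n + 1) ≫ e.inv) (B.bwdComp n ≫ e.inv) h
  have hi : i.hom ≫ (B.bwdComp n ≫ e.inv) = B.bwdComp (n + 1) ≫ e.inv := Subobject.ofMkLEMk_comp _
  have hi' : i.hom = B.bwd n := by
    rw [← cancel_mono (B.bwdComp n ≫ e.inv), hi]
    simp [Category.assoc]
  rw [← hi']
  infer_instance

/-- **In an ARTINIAN object every bi-chain has `βₙ` invertible for large `n`** (any category): the descending chain `Im δₙ ⊆ X`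
terminates. (Atiyah: «`Im(iₙ)` is a descending chain … Hence the bi-chain condition holds in `𝔄` if the ascending and descending chain
conditions both hold»; Krause: «the subobjects `Im(β₀ β₁ … βₙ) ⊆ X` yield a descending chain. If these chains terminate, then `αₙ` and
`βₙ` are invertible for large enough `n`.») [cite: Krause2015KS, §5 Lemma 5.1 (proof)] [cite: Atiyah1956, §3 (remark after the Definitions)] -/
theorem eventually_isIso_bwd_of_isArtinianObject [IsArtinianObject X] (e : X ≅ B.obj 0) :
    ∃ n₀ : ℕ, ∀ n, n₀ ≤ n → IsIso (B.bwd n) := by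
  obtain ⟨n₀, hn₀⟩ := antitone_chain_condition_of_isArtinianObject
    ⟨fun n => OrderDual.toDual (B.imageSubobjectSeq e n),
      fun a b hab => OrderDual.toDual_le_toDual.2 (B.antitone_imageSubobjectSeq e hab)⟩
  refine ⟨n₀, fun n hn => B.isIso_bwd_of_imageSubobjectSeq_eq e n ?_⟩
  have h1 := hn₀ n hn
  have h2 := hn₀ (n + 1) (by omega)
  change OrderDual.toDual (B.imageSubobjectSeq e n₀) = OrderDual.toDual (B.imageSubobjectSeq e n) at h1
  change OrderDual.toDual (B.imageSubobjectSeq e n₀) = OrderDual.toDual (B.imageSubobjectSeq e (n + 1)) at h2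
  exact OrderDual.toDual.injective (h2.symm.trans h1)

/-! ## §2 The ascending chain `Ker(αₙ₋₁ ⋯ α₁ α₀) ⊆ X` — noetherian objects of an abelian category -/

section Kernels

variable [HasZeroMorphisms C] [HasKernels C]

/-- The subobjects `Ker γₙ = Ker(αₙ₋₁ ⋯ α₁ α₀)` of `X ≅ X₀` (Krause: «the subobjects `Ker(αₙ … α₁ α₀) ⊆ X` yield an ascending chain»;
Atiyah: «`Ker(pₙ)` is an ascending chain»). [cite: Krause2015KS, §5 Lemma 5.1 (proof)] [cite: Atiyah1956, §3 (remark after the Definitions)] -/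
noncomputable def kernelSubobjectSeq (n : ℕ) : Subobject X :=
  kernelSubobject (e.hom ≫ B.fwdComp n)

/-- Unfolding `kernelSubobjectSeq`. [cite: Krause2015KS, §5 Lemma 5.1 (proof)] -/
theorem kernelSubobjectSeq_def (n : ℕ) : B.kernelSubobjectSeq e n = kernelSubobject (e.hom ≫ B.fwdComp n) := rfl

/-- The chain `Ker γₙ` is ascending (`γₙ₊₁ = γₙ ≫ αₙ`). [cite: Krause2015KS, §5 Lemma 5.1 (proof)] -/
theorem kernelSubobjectSeq_le_succ (n : ℕ) : B.kernelSubobjectSeq e n ≤ B.kernelSubobjectSeq e (n + 1) := by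
  rw [kernelSubobjectSeq_def, kernelSubobjectSeq_def]
  apply le_kernelSubobject
  rw [B.fwdComp_succ, ← Category.assoc e.hom, ← Category.assoc, kernelSubobject_arrow_comp, zero_comp]

/-- The chain `Ker γₙ` is monotone. [cite: Krause2015KS, §5 Lemma 5.1 (proof)] -/
theorem monotone_kernelSubobjectSeq : Monotone (B.kernelSubobjectSeq e) :=
  monotone_nat_of_le_succ fun n => B.kernelSubobjectSeq_le_succ e n

end Kernels

end Bichain

section Abelian

variable [Abelian C]

/-- The step of Lemma 5.1 that uses abelianness: if `g : X ↠ Y` is an EPIMORPHISM and `Ker(g ≫ f) ⊆ Ker g`, then `f` is a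
monomorphism.  (Pull the kernel `k` of `f` back along `g`: the pulled-back map is killed by `g ≫ f`, hence by `g`, so `k` vanishes after
the epimorphism `pullback.snd`.) [cite: Krause2015KS, §5 Lemma 5.1 (proof)] -/
theorem mono_of_epi_of_kernelSubobject_comp_le {X Y Z : C} (g : X ⟶ Y) [Epi g] (f : Y ⟶ Z) {gf : X ⟶ Z} (w : g ≫ f = gf)
    (h : kernelSubobject gf ≤ kernelSubobject g) : Mono f := by
  subst w
  apply Abelian.mono_of_kernel_ι_eq_zero
  have hfac : (kernelSubobject g).Factors (pullback.fst g (kernel.ι f)) := by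
    refine Subobject.factors_of_le _ h ?_
    rw [kernelSubobject_factors_iff, ← Category.assoc, pullback.condition, Category.assoc, kernel.condition, comp_zero]
  have h0 : pullback.fst g (kernel.ι f) ≫ g = 0 := (kernelSubobject_factors_iff g _).1 hfac
  have h1 : pullback.snd g (kernel.ι f) ≫ kernel.ι f = 0 := by rw [← pullback.condition, h0]
  exact zero_of_epi_comp _ h1

namespace Bichain

variable (B : Bichain C) {X : C} (e : X ≅ B.obj 0)

/-- If `Ker γₙ₊₁ = Ker γₙ` (even `≤`) then `αₙ` is invertible: it is a monomorphism by `mono_of_epi_of_kernelSubobject_comp_le` (`γₙ` is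
epi) and an epimorphism by assumption, and an abelian category is balanced. [cite: Krause2015KS, §5 Lemma 5.1 (proof)] -/
theorem isIso_fwd_of_kernelSubobjectSeq_le (n : ℕ) (h : B.kernelSubobjectSeq e (n + 1) ≤ B.kernelSubobjectSeq e n) :
    IsIso (B.fwd n) := by
  haveI := B.epi_fwdComp n
  haveI : Epi (e.hom ≫ B.fwdComp n) := epi_comp _ _
  haveI := B.epi_fwd n
  haveI : Mono (B.fwd n) :=
    mono_of_epi_of_kernelSubobject_comp_le (e.hom ≫ B.fwdComp n) (B.fwd n) (gf := e.hom ≫ B.fwdComp (n + 1))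
      (by simp [Category.assoc]) h
  exact isIso_of_mono_of_epi _

/-- **In a NOETHERIAN object of an abelian category every bi-chain has `αₙ` invertible for large `n`**: the ascending chain
`Ker γₙ ⊆ X` terminates. [cite: Krause2015KS, §5 Lemma 5.1 (proof)] [cite: Atiyah1956, §3 (remark after the Definitions)] -/
theorem eventually_isIso_fwd_of_isNoetherianObject [IsNoetherianObject X] (e : X ≅ B.obj 0) :
    ∃ n₀ : ℕ, ∀ n, n₀ ≤ n → IsIso (B.fwd n) := by
  obtain ⟨n₀, hn₀⟩ := monotone_chain_condition_of_isNoetherianObject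
    ⟨fun n => B.kernelSubobjectSeq e n, B.monotone_kernelSubobjectSeq e⟩
  refine ⟨n₀, fun n hn => B.isIso_fwd_of_kernelSubobjectSeq_le e n (le_of_eq ?_)⟩
  have h1 := hn₀ n hn
  have h2 := hn₀ (n + 1) (by omega)
  exact (h2.symm.trans h1 : B.kernelSubobjectSeq e (n + 1) = B.kernelSubobjectSeq e n)

end Bichain

/-- **Krause Lemma 5.1 ∕ Atiyah §3**: «An object of finite length satisfies the bi-chain condition» — precisely, an object of an abelian
category which is both ARTINIAN and NOETHERIAN (descending and ascending chain conditions on subobjects; Krause: «`X` has finite length if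
and only if `X` is both artinian … and noetherian») satisfies the bi-chain condition.  Atiyah: «if `{Aₙ, iₙ, pₙ}` is a bi-chain of `𝔄`,
`Im(iₙ)` is a descending chain and `Ker(pₙ)` is an ascending chain. Hence the bi-chain condition holds in `𝔄` if the ascending and
descending chain conditions both hold.» [cite: Krause2015KS, §5 Lemma 5.1] [cite: Atiyah1956, §3 (remark after the Definitions)] -/
theorem bichainCondition_of_isArtinianObject_of_isNoetherianObject (X : C) [IsArtinianObject X] [IsNoetherianObject X] :
    BichainCondition X := by
  intro B ⟨e⟩
  obtain ⟨n₁, hn₁⟩ := B.eventually_isIso_bwd_of_isArtinianObject e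
  obtain ⟨n₂, hn₂⟩ := B.eventually_isIso_fwd_of_isNoetherianObject e
  exact ⟨max n₁ n₂, fun n hn => ⟨hn₂ n (le_of_max_le_right hn), hn₁ n (le_of_max_le_left hn)⟩⟩

/-- Hence in an abelian category which is artinian and noetherian (Mathlib's `Artinian C`, `Noetherian C`: every object is) — e.g. a
category of objects of finite length — every object satisfies the bi-chain condition: Atiyah's «the bi-chain condition holds in `𝔄` if
the ascending and descending chain conditions both hold». [cite: Atiyah1956, §3 (remark after the Definitions)] [cite: Krause2015KS, §5 Lemma 5.1] -/
theorem bichainCondition_of_artinian_of_noetherian [Artinian C] [Noetherian C] (X : C) : BichainCondition X :=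
  bichainCondition_of_isArtinianObject_of_isNoetherianObject X

end Abelian

end Literature.CategoryTheory.KrullSchmidt
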